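import Summits.ResolutionOfSingularities.ResolutionOfSingularities.Theorems.MonomialTowerClasses
import HarnessLib

/-!
# CornerTowerDynamicsThree — the three-letter Euclid dynamics on `ℤ³` (pure integers; `dyn3_eventually`)
(decomp-res node «ProximityCut» rev 3, lens-3 g12, sha256 e1d6297007058045; CRITIC-LEDGER row 84 CLEARED-REV3,
filing order (W5);
co-credit lens-5 g13 `Theorems/CornerTowerDescent`, row 82)

[WRITER NOTE (decomp-res writer g5).  Second of the three W5 modules (namespace `…Theorems.CornerTowerDynamics`): lens
§6b `section Dyn3` (:1278–:1600) VERBATIM, preceded by the lens's §6b module docstring (:1261–:1276) verbatim — its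
E-model CONSEQUENCE paragraph (`NoOriginTails`, `noOriginTails_holds`, `no_origin_tail_rec`, `no_triply_thin`,
`lineage_eventually_fat3`, `false_of_fat`) describes W6 material (`Theorems/ProximityCutClasses`), not declarations of
this file; «§6» there = `CornerTowerDynamicsTwo`.  The critic pre-tested the Lyapunov claim by enumeration
(`y ∈ [−9,9]³`: 7 767 non-idle transitions, 0 violations; row 82).  plus `fin3_pair` (lens :930–:935, `Fin 3`
bookkeeping used by `noCornerTower_four` and W6).  0 sorry; one
support definition `nrm3`.]
(Sources: Hauser2010 Lecture IX; BierstoneGrigorievMilmanWlodarczyk2011, §3.)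
-/

namespace Summit.ResolutionOfSingularities.ResolutionOfSingularities.Theorems.CornerTowerDynamics

/-! ## §6b NO ORIGIN TAILS AT ALL — PROVED IN LEAN (g12 addendum rev 3: the three-letter dynamics)

The two-letter exit lemma of §6 extends to THREE letters: `y ∈ ℤ³`, a step with letter `j` keeps `y_j` and adds
`y_j` to the two other coordinates; if `y` is never TRIPLY negative and every letter recurs, then `y ≥ 0`
eventually (`dyn3_eventually`).  LYAPUNOV FUNCTION: the `ℓ¹`-norm `‖y‖₁` never increases outside the absorbing
octant, and strictly drops (or the octant is entered) at the next NON-IDLE step of the right kind — with exactly one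
negative coordinate `a` at the next `a`-step (`dyn3_phase1`; in between, `b`/`c`-steps only transfer mass from `|y_a|`
to the positive side), with two negative coordinates `a, b` at the next `c`-step (`dyn3_phase2`; in between,
`a`/`b`-steps transfer `y_c` into `|y_b|`, `|y_a|`); idle configurations (`y_a < 0 = y_b = y_c`, resp.
`y_a, y_b < 0 = y_c`) are impossible because the next `a`- (resp. `a`/`b`-) step would be triply negative
(`dyn3_pos1`, `dyn3_pos2`).  CONSEQUENCE (E-model, port-free, all `e ≥ 1`): **no forced walk from a root sits at
the ORIGIN of its charts from some stage on** (`NoOriginTails`, `noOriginTails_holds`): ≤ 2 recurring charts is §6,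
three recurring charts is `no_origin_tail_rec` (triply thin monomials descend, `no_triply_thin`; lineages fatten in
every direction, `lineage_eventually_fat3`; pigeonhole; `false_of_fat`).  Every chart change at the origin is a
proximity repeat, so this is a DECIDED PIECE INSIDE THE RESIDUAL `NoRecurrentProximity(Deep)`: the residual is now
«tails through infinitely many NON-ORIGIN (translated, `b_t ≠ 0`) centres with recurrent proximity». -/

section Dyn3

variable {y : ℕ → Fin 3 → ℤ} {w : ℕ → Fin 3}

/-- The `ℓ¹`-norm of a defect vector.  DEFINITION (support). -/
def nrm3 (v : Fin 3 → ℤ) : ℕ := (v 0).natAbs + (v 1).natAbs + (v 2).natAbs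

/-- `‖v‖₁` in any labelling of the coordinates. [folklore] -/
theorem nrm3_perm (v : Fin 3 → ℤ) {a b c : Fin 3} (hab : a ≠ b) (hac : a ≠ c) (hbc : b ≠ c) :
    nrm3 v = (v a).natAbs + (v b).natAbs + (v c).natAbs := by
  unfold nrm3
  fin_cases a <;> fin_cases b <;> fin_cases c <;> simp_all <;> omega

/-- The played coordinate is kept. [folklore] -/
theorem dyn3_self (hstep : ∀ n x, y (n + 1) x = if x = w n then y n x else y n x + y n (w n)) (n : ℕ) :
    y (n + 1) (w n) = y n (w n) := by
  rw [hstep, if_pos rfl]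

/-- The other coordinates gain `y_{w n}`. [folklore] -/
theorem dyn3_ne (hstep : ∀ n x, y (n + 1) x = if x = w n then y n x else y n x + y n (w n)) (n : ℕ)
    {x : Fin 3} (hx : x ≠ w n) : y (n + 1) x = y n x + y n (w n) := by
  rw [hstep, if_neg hx]

/-- The octant `y ≥ 0` is absorbing. [folklore] -/
theorem dyn3_absorb (hstep : ∀ n x, y (n + 1) x = if x = w n then y n x else y n x + y n (w n)) {n : ℕ}
    (hn : ∀ x, 0 ≤ y n x) : ∀ m, n ≤ m → ∀ x, 0 ≤ y m x := by
  intro m hm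
  induction m, hm using Nat.le_induction with
  | base => exact hn
  | succ m hm ih =>
    intro x
    rw [hstep]
    split_ifs
    · exact ih x
    · exact add_nonneg (ih x) (ih (w m))

/-- Idle stretches: while only letters with value `0` are played, nothing moves. [folklore] -/
theorem dyn3_frozen (hstep : ∀ n x, y (n + 1) x = if x = w n then y n x else y n x + y n (w n)) {n : ℕ}
    (Z : Fin 3 → Prop) (hZ : ∀ z, Z z → y n z = 0) :
    ∀ m, n ≤ m → (∀ t, n ≤ t → t < m → Z (w t)) → ∀ x, y m x = y n x := by
  intro m hm
  induction m, hm using Nat.le_induction with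
  | base => exact fun _ _ => rfl
  | succ m hm ih =>
    intro hw x
    have ih' := ih (fun t ht htm => hw t ht (by omega))
    have h0 : y m (w m) = 0 := by rw [ih' (w m)]; exact hZ _ (hw m hm (by omega))
    rw [hstep]
    split_ifs
    · exact ih' x
    · rw [h0, add_zero]; exact ih' x

/-- No idle two-negative configuration `y_a, y_b < 0 = y_c`: the `c`-steps are idle and the next `a`/`b`-step is
triply negative. [folklore] -/
theorem dyn3_pos2 (hstep : ∀ n x, y (n + 1) x = if x = w n then y n x else y n x + y n (w n))
    (halive : ∀ n, ∃ x, 0 ≤ y n x) (hrec : ∀ x n, ∃ m, n ≤ m ∧ w m = x) {a b c : Fin 3}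
    (hab : a ≠ b) (hac : a ≠ c) (hbc : b ≠ c) (hcov : ∀ x, x = a ∨ x = b ∨ x = c) {n : ℕ}
    (ha : y n a < 0) (hb : y n b < 0) (hc : y n c = 0) : False := by
  classical
  have hex : ∃ m, n ≤ m ∧ w m ≠ c := by
    obtain ⟨m, hm, hwm⟩ := hrec a n
    exact ⟨m, hm, by rw [hwm]; exact hac⟩
  let m := Nat.find hex
  have hm : n ≤ m ∧ w m ≠ c := Nat.find_spec hex
  have hmin : ∀ t, t < m → ¬ (n ≤ t ∧ w t ≠ c) := fun t ht => Nat.find_min hex ht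
  have hfr := dyn3_frozen hstep (fun z => z = c) (fun z hz => by rw [hz]; exact hc) m hm.1
    (fun t ht htm => by
      by_contra hne
      exact hmin t htm ⟨ht, hne⟩)
  -- the step at `m` (letter `u ∈ {a, b}`, the other one `v`) makes all three coordinates negative
  have key : ∀ {u v : Fin 3}, v ≠ u → c ≠ u → (∀ x, x = u ∨ x = v ∨ x = c) → y n u < 0 → y n v < 0 →
      w m = u → False := by
    intro u v hvu hcu hcov' hu hv hwu
    have eu : y (m + 1) u = y n u := by rw [← hwu, dyn3_self hstep, hfr]
    have ev : y (m + 1) v = y n v + y n u := by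
      rw [dyn3_ne hstep m (by rw [hwu]; exact hvu), hwu, hfr, hfr]
    have ec : y (m + 1) c = y n c + y n u := by
      rw [dyn3_ne hstep m (by rw [hwu]; exact hcu), hwu, hfr, hfr]
    obtain ⟨x, hx⟩ := halive (m + 1)
    rcases hcov' x with rfl | rfl | rfl
    · rw [eu] at hx; omega
    · rw [ev] at hx; omega
    · rw [ec] at hx; omega
  rcases hcov (w m) with hwa | hwb | hwc
  · exact key (Ne.symm hab) (Ne.symm hac) hcov ha hb hwa
  · exact key hab (Ne.symm hbc) (fun x => by
      rcases hcov x with h | h | h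
      exacts [Or.inr (Or.inl h), Or.inl h, Or.inr (Or.inr h)]) hb ha hwb
  · exact hm.2 hwc

/-- No idle one-negative configuration `y_a < 0 = y_b = y_c`: the `b`/`c`-steps are idle and the next `a`-step is
triply negative. [folklore] -/
theorem dyn3_pos1 (hstep : ∀ n x, y (n + 1) x = if x = w n then y n x else y n x + y n (w n))
    (halive : ∀ n, ∃ x, 0 ≤ y n x) (hrec : ∀ x n, ∃ m, n ≤ m ∧ w m = x) {a b c : Fin 3}
    (hab : a ≠ b) (hac : a ≠ c) (hcov : ∀ x, x = a ∨ x = b ∨ x = c) {n : ℕ}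
    (ha : y n a < 0) (hb : y n b = 0) (hc : y n c = 0) : False := by
  classical
  have hex : ∃ m, n ≤ m ∧ w m = a := hrec a n
  let m := Nat.find hex
  have hm : n ≤ m ∧ w m = a := Nat.find_spec hex
  have hmin : ∀ t, t < m → ¬ (n ≤ t ∧ w t = a) := fun t ht => Nat.find_min hex ht
  have hfr := dyn3_frozen hstep (fun z => z = b ∨ z = c)
    (fun z hz => by rcases hz with hz | hz <;> rw [hz] <;> assumption) m hm.1
    (fun t ht htm => by
      rcases hcov (w t) with h | h | h
      · exact absurd ⟨ht, h⟩ (hmin t htm)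
      · exact Or.inl h
      · exact Or.inr h)
  have ea : y (m + 1) a = y n a := by rw [← hm.2, dyn3_self hstep, hfr]
  have eb : y (m + 1) b = y n b + y n a := by
    rw [dyn3_ne hstep m (by rw [hm.2]; exact Ne.symm hab), hm.2, hfr, hfr]
  have ec : y (m + 1) c = y n c + y n a := by
    rw [dyn3_ne hstep m (by rw [hm.2]; exact Ne.symm hac), hm.2, hfr, hfr]
  obtain ⟨x, hx⟩ := halive (m + 1)
  rcases hcov x with rfl | rfl | rfl
  · rw [ea] at hx; omega
  · rw [eb] at hx; omega
  · rw [ec] at hx; omega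

/-- **PHASE 2 (two negative coordinates `a, b`; `y_c ≥ 0`).**  Until the next `c`-step the norm is constant; at it
the norm drops or the octant is entered. [folklore] -/
theorem dyn3_phase2 (hstep : ∀ n x, y (n + 1) x = if x = w n then y n x else y n x + y n (w n))
    (halive : ∀ n, ∃ x, 0 ≤ y n x) (hrec : ∀ x n, ∃ m, n ≤ m ∧ w m = x) {ν : ℕ}
    (IH : ∀ n, nrm3 (y n) ≤ ν → ∃ n', ∀ x, 0 ≤ y n' x) {a b c : Fin 3}
    (hab : a ≠ b) (hac : a ≠ c) (hbc : b ≠ c) (hcov : ∀ x, x = a ∨ x = b ∨ x = c) (n : ℕ)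
    (ha : y n a < 0) (hb : y n b < 0) (hc : 0 ≤ y n c) (hν : nrm3 (y n) ≤ ν + 1) :
    ∃ n', ∀ x, 0 ≤ y n' x := by
  classical
  have hex : ∃ m, n ≤ m ∧ w m = c := hrec c n
  let m := Nat.find hex
  have hm : n ≤ m ∧ w m = c := Nat.find_spec hex
  have hmin : ∀ t, t < m → ¬ (n ≤ t ∧ w t = c) := fun t ht => Nat.find_min hex ht
  -- invariant up to the `c`-step
  have inv : ∀ t, n ≤ t → t ≤ m → y t a < 0 ∧ y t b < 0 ∧ 0 ≤ y t c ∧ nrm3 (y t) ≤ ν + 1 := by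
    intro t ht
    induction t, ht using Nat.le_induction with
    | base => exact fun _ => ⟨ha, hb, hc, hν⟩
    | succ t ht ih =>
      intro htm
      obtain ⟨ia, ib, ic, iν⟩ := ih (by omega)
      have hwt : w t ≠ c := fun h => hmin t (by omega) ⟨ht, h⟩
      have e0 := nrm3_perm (y t) hab hac hbc
      have e1 := nrm3_perm (y (t + 1)) hab hac hbc
      obtain ⟨x, hx⟩ := halive (t + 1)
      -- the letter is `u ∈ {a, b}`, the other negative one is `v`
      have key : ∀ {u v : Fin 3}, v ≠ u → c ≠ u → (∀ x, x = u ∨ x = v ∨ x = c) → y t u < 0 → y t v < 0 →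
          w t = u → y (t + 1) u < 0 ∧ y (t + 1) v < 0 ∧ 0 ≤ y (t + 1) c ∧
            (y (t + 1) u).natAbs + (y (t + 1) v).natAbs + (y (t + 1) c).natAbs =
              (y t u).natAbs + (y t v).natAbs + (y t c).natAbs := by
        intro u v hvu hcu hcov' hu hv hwu
        have eu : y (t + 1) u = y t u := by rw [← hwu, dyn3_self hstep]
        have ev : y (t + 1) v = y t v + y t u := by rw [dyn3_ne hstep t (by rw [hwu]; exact hvu), hwu]
        have ec : y (t + 1) c = y t c + y t u := by rw [dyn3_ne hstep t (by rw [hwu]; exact hcu), hwu]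
        have hc' : 0 ≤ y (t + 1) c := by
          rcases hcov' x with rfl | rfl | rfl
          · rw [eu] at hx; omega
          · rw [ev] at hx; omega
          · exact hx
        refine ⟨by rw [eu]; exact hu, by rw [ev]; omega, hc', ?_⟩
        rw [ec] at hc' ⊢
        rw [eu, ev]
        omega
      rcases hcov (w t) with hwa | hwb | hwc
      · obtain ⟨g1, g2, g3, g4⟩ := key (Ne.symm hab) (Ne.symm hac) hcov ia ib hwa
        exact ⟨g1, g2, g3, by omega⟩
      · obtain ⟨g1, g2, g3, g4⟩ := key hab (Ne.symm hbc) (fun x => by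
          rcases hcov x with h | h | h
          exacts [Or.inr (Or.inl h), Or.inl h, Or.inr (Or.inr h)]) ib ia hwb
        exact ⟨g2, g1, g3, by omega⟩
      · exact absurd hwc hwt
  obtain ⟨ma, mb, mc, mν⟩ := inv m hm.1 le_rfl
  -- the `c`-step at `m`
  rcases lt_or_eq_of_le mc with mc | mc
  swap
  · exact (dyn3_pos2 hstep halive hrec hab hac hbc hcov ma mb mc.symm).elim
  have ea : y (m + 1) a = y m a + y m c := by rw [dyn3_ne hstep m (by rw [hm.2]; exact hac), hm.2]
  have eb : y (m + 1) b = y m b + y m c := by rw [dyn3_ne hstep m (by rw [hm.2]; exact hbc), hm.2]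
  have ec : y (m + 1) c = y m c := by rw [← hm.2, dyn3_self hstep, hm.2]
  by_cases hgood : 0 ≤ y (m + 1) a ∧ 0 ≤ y (m + 1) b
  · refine ⟨m + 1, fun x => ?_⟩
    rcases hcov x with rfl | rfl | rfl
    · exact hgood.1
    · exact hgood.2
    · rw [ec]; exact le_of_lt mc
  · -- the norm dropped
    refine IH (m + 1) ?_
    have e0 := nrm3_perm (y m) hab hac hbc
    have e1 := nrm3_perm (y (m + 1)) hab hac hbc
    rw [e1, ea, eb, ec]
    rw [e0] at mν
    rw [ea, eb] at hgood
    omega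

/-- **PHASE 1 (one negative coordinate `a`).**  Until the next `a`-step only transfers happen; at it the norm drops
or phase 2 is entered with the norm not increased. [folklore] -/
theorem dyn3_phase1 (hstep : ∀ n x, y (n + 1) x = if x = w n then y n x else y n x + y n (w n))
    (halive : ∀ n, ∃ x, 0 ≤ y n x) (hrec : ∀ x n, ∃ m, n ≤ m ∧ w m = x) {ν : ℕ}
    (IH : ∀ n, nrm3 (y n) ≤ ν → ∃ n', ∀ x, 0 ≤ y n' x) {a b c : Fin 3}
    (hab : a ≠ b) (hac : a ≠ c) (hbc : b ≠ c) (hcov : ∀ x, x = a ∨ x = b ∨ x = c) (n : ℕ)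
    (ha : y n a < 0) (hb : 0 ≤ y n b) (hc : 0 ≤ y n c) (hν : nrm3 (y n) ≤ ν + 1) :
    ∃ n', ∀ x, 0 ≤ y n' x := by
  classical
  have hex : ∃ m, n ≤ m ∧ w m = a := hrec a n
  let m := Nat.find hex
  have hm : n ≤ m ∧ w m = a := Nat.find_spec hex
  have hmin : ∀ t, t < m → ¬ (n ≤ t ∧ w t = a) := fun t ht => Nat.find_min hex ht
  -- invariant up to the `a`-step: absorbed at some stage, or still in phase 1 with the same norm bound
  have inv : ∀ t, n ≤ t → t ≤ m → (∃ n', ∀ x, 0 ≤ y n' x) ∨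
      (y t a < 0 ∧ 0 ≤ y t b ∧ 0 ≤ y t c ∧ nrm3 (y t) ≤ ν + 1) := by
    intro t ht
    induction t, ht using Nat.le_induction with
    | base => exact fun _ => Or.inr ⟨ha, hb, hc, hν⟩
    | succ t ht ih =>
      intro htm
      rcases ih (by omega) with hdone | ⟨ia, ib, ic, iν⟩
      · exact Or.inl hdone
      have hwt : w t ≠ a := fun h => hmin t (by omega) ⟨ht, h⟩
      have e0 := nrm3_perm (y t) hab hac hbc
      have e1 := nrm3_perm (y (t + 1)) hab hac hbc
      -- the letter is `u ∈ {b, c}` (value `≥ 0`), the other non-negative one is `v`: a transfer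
      have key : ∀ {u v : Fin 3}, a ≠ u → v ≠ u → (∀ x, x = a ∨ x = u ∨ x = v) → 0 ≤ y t u → 0 ≤ y t v →
          w t = u → (∃ n', ∀ x, 0 ≤ y n' x) ∨ (y (t + 1) a < 0 ∧ 0 ≤ y (t + 1) u ∧ 0 ≤ y (t + 1) v ∧
            (y (t + 1) a).natAbs + (y (t + 1) u).natAbs + (y (t + 1) v).natAbs =
              (y t a).natAbs + (y t u).natAbs + (y t v).natAbs) := by
        intro u v hau hvu hcov' hu hv hwu
        have eu : y (t + 1) u = y t u := by rw [← hwu, dyn3_self hstep]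
        have ev : y (t + 1) v = y t v + y t u := by rw [dyn3_ne hstep t (by rw [hwu]; exact hvu), hwu]
        have ea : y (t + 1) a = y t a + y t u := by rw [dyn3_ne hstep t (by rw [hwu]; exact hau), hwu]
        by_cases hheal : 0 ≤ y (t + 1) a
        · refine Or.inl ⟨t + 1, fun x => ?_⟩
          rcases hcov' x with rfl | rfl | rfl
          · exact hheal
          · rw [eu]; exact hu
          · rw [ev]; exact add_nonneg hv hu
        · push Not at hheal
          refine Or.inr ⟨hheal, by rw [eu]; exact hu, by rw [ev]; exact add_nonneg hv hu, ?_⟩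
          rw [ea] at hheal ⊢
          rw [eu, ev]
          omega
      rcases hcov (w t) with hwa | hwb | hwc
      · exact absurd hwa hwt
      · rcases key hab (Ne.symm hbc) hcov ib ic hwb with hdone | ⟨g1, g2, g3, g4⟩
        · exact Or.inl hdone
        · exact Or.inr ⟨g1, g2, g3, by omega⟩
      · rcases key hac hbc (fun x => by
          rcases hcov x with h | h | h
          exacts [Or.inl h, Or.inr (Or.inr h), Or.inr (Or.inl h)]) ic ib hwc with hdone | ⟨g1, g2, g3, g4⟩
        · exact Or.inl hdone
        · exact Or.inr ⟨g1, g3, g2, by omega⟩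
  rcases inv m hm.1 le_rfl with hdone | ⟨ma, mb, mc, mν⟩
  · exact hdone
  -- the `a`-step at `m`
  have hnz : ¬ (y m b = 0 ∧ y m c = 0) := fun h => dyn3_pos1 hstep halive hrec hab hac hcov ma h.1 h.2
  have ea : y (m + 1) a = y m a := by rw [← hm.2, dyn3_self hstep, hm.2]
  have eb : y (m + 1) b = y m b + y m a := by rw [dyn3_ne hstep m (by rw [hm.2]; exact Ne.symm hab), hm.2]
  have ec : y (m + 1) c = y m c + y m a := by rw [dyn3_ne hstep m (by rw [hm.2]; exact Ne.symm hac), hm.2]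
  have e0 := nrm3_perm (y m) hab hac hbc
  have e1 := nrm3_perm (y (m + 1)) hab hac hbc
  obtain ⟨x, hx⟩ := halive (m + 1)
  have hnot3 : 0 ≤ y (m + 1) b ∨ 0 ≤ y (m + 1) c := by
    rcases hcov x with rfl | rfl | rfl
    · rw [ea] at hx; omega
    · exact Or.inl hx
    · exact Or.inr hx
  by_cases hB : 0 ≤ y (m + 1) b <;> by_cases hC : 0 ≤ y (m + 1) c
  · -- both stay non-negative: the norm dropped by `2|y_a|`
    refine IH (m + 1) ?_
    rw [e1, ea, eb, ec]; rw [e0] at mν; rw [eb] at hB; rw [ec] at hC; omega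
  · -- `c` turned negative: phase 2 with `(a, c | b)`
    push Not at hC
    refine dyn3_phase2 hstep halive hrec IH hac hab (Ne.symm hbc) (fun x => by
      rcases hcov x with h | h | h
      exacts [Or.inl h, Or.inr (Or.inr h), Or.inr (Or.inl h)]) (m + 1) (by rw [ea]; exact ma) hC hB ?_
    rw [e1, ea, eb, ec]; rw [e0] at mν; rw [eb] at hB; rw [ec] at hC; omega
  · -- `b` turned negative: phase 2 with `(a, b | c)`
    push Not at hB
    refine dyn3_phase2 hstep halive hrec IH hab hac hbc hcov (m + 1) (by rw [ea]; exact ma) hB hC ?_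
    rw [e1, ea, eb, ec]; rw [e0] at mν; rw [eb] at hB; rw [ec] at hC; omega
  · exact absurd hnot3 (by push Not; exact ⟨lt_of_not_ge hB, lt_of_not_ge hC⟩)

/-- The engine: from any stage the octant is reached (strong induction on `‖y‖₁`). [folklore] -/
theorem dyn3_reach (hstep : ∀ n x, y (n + 1) x = if x = w n then y n x else y n x + y n (w n))
    (halive : ∀ n, ∃ x, 0 ≤ y n x) (hrec : ∀ x n, ∃ m, n ≤ m ∧ w m = x) :
    ∀ (ν : ℕ) (n : ℕ), nrm3 (y n) ≤ ν → ∃ n', ∀ x, 0 ≤ y n' x := by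
  intro ν
  induction ν with
  | zero =>
    intro n hν
    refine ⟨n, fun x => ?_⟩
    unfold nrm3 at hν
    fin_cases x <;> simp <;> omega
  | succ ν ih =>
    intro n hν
    by_cases h0 : 0 ≤ y n 0 <;> by_cases h1 : 0 ≤ y n 1 <;> by_cases h2 : 0 ≤ y n 2
    · exact ⟨n, fun x => by fin_cases x <;> assumption⟩
    · exact dyn3_phase1 hstep halive hrec ih (a := 2) (b := 0) (c := 1) (by decide) (by decide) (by decide)
        (fun x => by fin_cases x <;> simp) n (lt_of_not_ge h2) h0 h1 hν
    · exact dyn3_phase1 hstep halive hrec ih (a := 1) (b := 0) (c := 2) (by decide) (by decide) (by decide)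
        (fun x => by fin_cases x <;> simp) n (lt_of_not_ge h1) h0 h2 hν
    · exact dyn3_phase2 hstep halive hrec ih (a := 1) (b := 2) (c := 0) (by decide) (by decide) (by decide)
        (fun x => by fin_cases x <;> simp) n (lt_of_not_ge h1) (lt_of_not_ge h2) h0 hν
    · exact dyn3_phase1 hstep halive hrec ih (a := 0) (b := 1) (c := 2) (by decide) (by decide) (by decide)
        (fun x => by fin_cases x <;> simp) n (lt_of_not_ge h0) h1 h2 hν
    · exact dyn3_phase2 hstep halive hrec ih (a := 0) (b := 2) (c := 1) (by decide) (by decide) (by decide)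
        (fun x => by fin_cases x <;> simp) n (lt_of_not_ge h0) (lt_of_not_ge h2) h1 hν
    · exact dyn3_phase2 hstep halive hrec ih (a := 0) (b := 1) (c := 2) (by decide) (by decide) (by decide)
        (fun x => by fin_cases x <;> simp) n (lt_of_not_ge h0) (lt_of_not_ge h1) h2 hν
    · exfalso
      obtain ⟨x, hx⟩ := halive n
      fin_cases x
      · exact h0 hx
      · exact h1 hx
      · exact h2 hx

/-- **THREE-LETTER EUCLID DYNAMICS (PROVED):** never triply negative + all three letters recurring ⇒ eventually in
the octant `y ≥ 0`. [folklore] -/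
theorem dyn3_eventually (hstep : ∀ n x, y (n + 1) x = if x = w n then y n x else y n x + y n (w n))
    (halive : ∀ n, ∃ x, 0 ≤ y n x) (hrec : ∀ x n, ∃ m, n ≤ m ∧ w m = x) :
    ∃ n₀, ∀ n, n₀ ≤ n → ∀ x, 0 ≤ y n x := by
  obtain ⟨n', hn'⟩ := dyn3_reach hstep halive hrec (nrm3 (y 0)) 0 le_rfl
  exact ⟨n', dyn3_absorb hstep hn'⟩

end Dyn3

/-- Two coordinates off `k` exhaust the charts avoiding `k` (`Fin 3` bookkeeping). [folklore] -/
theorem fin3_pair (k : Fin 3) : ∃ i i' : Fin 3, i ≠ k ∧ i' ≠ k ∧ i ≠ i' ∧ ∀ j, j ≠ k → j = i ∨ j = i' := by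
  fin_cases k
  · exact ⟨1, 2, by decide, by decide, by decide, by decide⟩
  · exact ⟨0, 2, by decide, by decide, by decide, by decide⟩
  · exact ⟨0, 1, by decide, by decide, by decide, by decide⟩

end Summit.ResolutionOfSingularities.ResolutionOfSingularities.Theorems.CornerTowerDynamics
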